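import Literature.MathematicalPhysics.QuantumFieldTheory.WilsonFinTorusTwistedPartition
import HarnessLib

/-!
# Line «open-cube-continuity» (crux `IRcof`, stmt-QuantumFields-26930) — the discrete (non-abelian) Poincaré lemma of the
# OPEN cube: a lattice gauge field on `{0..M}³` with trivial holonomy around every plaquette is a pure gauge (helper (h1))

Helper for `Summit.QuantumFields.YangMills.Theses.BalabanLadder.IRcof` (stmt-QuantumFields-26930), wave-2 line
«open-cube-continuity» (ideator ym-ir-idea-20 g2, lens `resurrect`; workfile `Cruxes/IRcof/Lines/open_cube_continuity.lean`
tree 5e158022728a; critic ym-ir-crit-3 g3 2026-08-28T19:47:10Z PASS-WITH-PRICE, census row 46: «Pool-p3 cheap helpers that are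
genuinely on O1's path: (h1) discrete Poincaré lemma on the box — closed 1-cochains on the cubical complex `[0,M]³` are exact
(`H¹ = 0`), kernel-sized»; G2(a): «`H¹([0,M]³) = 0` (contractible; lattice-flat ⇒ pure gauge for ANY `G` since the 2-complex is
simply connected) ⇒ NO zero mode modulo gauge»).  Everything here is PROVED; no definition, no named fact; no stub of the line is
touched.  This is the FIRST input of the open-cube anchor O1 (`OpenCubeAnchor`): the minima of the spatial plaquette energy of
ONE time slice of the open cube `{0..M}³ × (ℤ/t)` — the flat fields — form ONE gauge orbit (that of the trivial field), for
EVERY group `G` (no centre, no `π₁`, no abelian ∕ non-abelian distinction; the periodic box instead has the torons).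

CONTENT.  A spatial slice of the line's open cube is a link field `a : FinSpatialSite (M+1) (M+1) (M+1) × Fin 3 → G` on the
`Fin`-box of the tree's transfer formalism (`WilsonFinTorusSliceKernel`: sites `Fin (M+1)³`, periodic shifts `FinSpatialSite.shift`),
of which only the NON-wrapping links `(p, i)`, `pᵢ < M`, and plaquettes `(p; i, j)`, `pᵢ < M ∧ pⱼ < M`, belong to the open cube
(the line's `openInd`; coordinates `finSpatialCoord` of `WilsonFinTorusTwistedPartition`).  MAIN: `exists_gauge_of_plaquette_eq_one`
— if `a(p,i) a(p+eᵢ,j) a(p+eⱼ,i)⁻¹ a(p,j)⁻¹ = 1` for every non-wrapping plaquette, then there is `g : sites → G` with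
`a(p,i) = g(p) g(p+eᵢ)⁻¹` on every non-wrapping link (`= finSliceGaugeTransform g 1`, the gauge transform of the trivial field:
`exists_eq_gaugeTransform_one_of_plaquette_eq_one`).  Proof: parallel transport along the lexicographic paths (axis `0`, then
`1`, then `2`) from the corner; path independence by induction on the coordinates, one flat plaquette of the planes `(1,2)`,
`(0,1)`, `(0,2)` per step.  The ℕ³-parametrisation of the sites (`(x, y, z) ↦ (↑x, ↑y, ↑z)`, casts mod `M+1`, so that every shift
is `+1` on the parameters) and the transport are variables with their defining equations (§1): no definition is introduced.
Group-blind, every `M` (also `M = 0`).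

HONEST FRAMING: finite combinatorics of the cubical 2-complex of a solid cube; width toward PXcof ∕ `IRcof` ∕ `IR`: 0; the
line's content sits in its stubs O1–O3; nothing here proves the Yang–Mills mass gap (Clay) — NOT proved; R4 closes only the
conditional finite-𝕋⁴ rung `BalabanLadder.UV`.  [folklore: lattice Poincaré lemma ∕ maximal-tree (axial) gauge, e.g. E. Seiler,
LNP 159 (1982) Ch. 2]
-/

set_option autoImplicit false

open Literature.MathematicalPhysics.QuantumFieldTheory
open Fin.NatCast

namespace Summit.QuantumFields.YangMills.Cruxes.IRcof.OpenCubeContinuity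

/-! ## §0 The ℕ³-parametrisation of the `Fin`-box and its shifts -/

section Param

variable {M : ℕ}

/-- `↑(x+1) = ↑x + 1` in `Fin (M+1)` (casts mod `M+1`). -/
theorem natCast_succ_fin (x : ℕ) : ((x + 1 : ℕ) : Fin (M + 1)) = (x : Fin (M + 1)) + 1 := by
  ext
  rw [Fin.val_add, Fin.val_natCast, Fin.val_natCast, Fin.val_one', Nat.add_mod]

/-- The shift in direction `0` of the site `(↑x, ↑y, ↑z)` is `(↑(x+1), ↑y, ↑z)` (casts into `Fin (M+1)`; no bound needed). -/
theorem shift_cast_zero (x y z : ℕ) :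
    FinSpatialSite.shift (((x : Fin (M + 1)), (y : Fin (M + 1)), (z : Fin (M + 1))) : FinSpatialSite (M + 1) (M + 1) (M + 1)) 0 =
      (((x + 1 : ℕ) : Fin (M + 1)), (y : Fin (M + 1)), (z : Fin (M + 1))) := by
  show (finRotate (M + 1) _, _, _) = _
  rw [finRotate_apply, natCast_succ_fin]

/-- The shift in direction `1` of `(↑x, ↑y, ↑z)` is `(↑x, ↑(y+1), ↑z)`. -/
theorem shift_cast_one (x y z : ℕ) :
    FinSpatialSite.shift (((x : Fin (M + 1)), (y : Fin (M + 1)), (z : Fin (M + 1))) : FinSpatialSite (M + 1) (M + 1) (M + 1)) 1 =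
      ((x : Fin (M + 1)), ((y + 1 : ℕ) : Fin (M + 1)), (z : Fin (M + 1))) := by
  show (_, finRotate (M + 1) _, _) = _
  rw [finRotate_apply, natCast_succ_fin]

/-- The shift in direction `2` of `(↑x, ↑y, ↑z)` is `(↑x, ↑y, ↑(z+1))`. -/
theorem shift_cast_two (x y z : ℕ) :
    FinSpatialSite.shift (((x : Fin (M + 1)), (y : Fin (M + 1)), (z : Fin (M + 1))) : FinSpatialSite (M + 1) (M + 1) (M + 1)) 2 =
      ((x : Fin (M + 1)), (y : Fin (M + 1)), ((z + 1 : ℕ) : Fin (M + 1))) := by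
  show (_, _, finRotate (M + 1) _) = _
  rw [finRotate_apply, natCast_succ_fin]

/-- The coordinates of `(↑x, ↑y, ↑z)` are `x, y, z` when these are `≤ M`. -/
theorem finSpatialCoord_cast {x y z : ℕ} (hx : x ≤ M) (hy : y ≤ M) (hz : z ≤ M) (i : Fin 3) :
    finSpatialCoord ((((x : Fin (M + 1)), (y : Fin (M + 1)), (z : Fin (M + 1))) : FinSpatialSite (M + 1) (M + 1) (M + 1))) i =
      ![x, y, z] i := by
  have hx' := Fin.val_cast_of_lt (n := M + 1) (Nat.lt_succ_of_le hx)
  have hy' := Fin.val_cast_of_lt (n := M + 1) (Nat.lt_succ_of_le hy)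
  have hz' := Fin.val_cast_of_lt (n := M + 1) (Nat.lt_succ_of_le hz)
  fin_cases i
  · exact hx'
  · exact hy'
  · exact hz'

/-- Every site is `(↑x, ↑y, ↑z)` for its own coordinates. -/
theorem cast_coord_eq (p : FinSpatialSite (M + 1) (M + 1) (M + 1)) :
    ((((p.1 : ℕ) : Fin (M + 1)), ((p.2.1 : ℕ) : Fin (M + 1)), ((p.2.2 : ℕ) : Fin (M + 1))) :
      FinSpatialSite (M + 1) (M + 1) (M + 1)) = p := by
  ext <;> simp

end Param

/-! ## §1 Parallel transport along lexicographic paths and its path independence on flat fields -/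

section Transport

variable {G : Type*} [Group G] {M : ℕ} (a : FinSpatialSite (M + 1) (M + 1) (M + 1) × Fin 3 → G)
  (A : ℕ → ℕ → ℕ → Fin 3 → G)
  (hA : ∀ x y z i, A x y z i = a ((((x : Fin (M + 1)), (y : Fin (M + 1)), (z : Fin (M + 1))) :
    FinSpatialSite (M + 1) (M + 1) (M + 1)), i))
  (T : ℕ → ℕ → ℕ → G)
  (hT : ∀ x y z, T x y z = ((List.range x).map fun k => A k 0 0 0).prod *
    ((List.range y).map fun k => A x k 0 1).prod * ((List.range z).map fun k => A x y k 2).prod)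

include hT in
/-- Extending the path by one link in direction `2`. -/
theorem transport_succ_two (x y z : ℕ) : T x y (z + 1) = T x y z * A x y z 2 := by
  rw [hT, hT, List.prod_range_succ, ← mul_assoc]

include hT in
/-- Extending the path by one link in direction `1` (at height `z = 0`). -/
theorem transport_succ_one (x y : ℕ) : T x (y + 1) 0 = T x y 0 * A x y 0 1 := by
  rw [hT, hT, List.prod_range_succ]
  simp only [List.range_zero, List.map_nil, List.prod_nil, mul_one, mul_assoc]

include hT in
/-- Extending the path by one link in direction `0` (at `y = z = 0`). -/
theorem transport_succ_zero (x : ℕ) : T (x + 1) 0 0 = T x 0 0 * A x 0 0 0 := by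
  rw [hT, hT, List.prod_range_succ]
  simp only [List.range_zero, List.map_nil, List.prod_nil, mul_one]

/-- A flat non-wrapping plaquette in the plane `(i, j)` at `p = (↑x, ↑y, ↑z)` (`x, y, z ≤ M`, `pᵢ, pⱼ < M`), solved for the far
link: `a(p,j)⁻¹ a(p,i) a(p+eᵢ,j) = a(p+eⱼ,i)`. -/
theorem far_link_eq_of_flat (hflat : ∀ (p : FinSpatialSite (M + 1) (M + 1) (M + 1)) (i j : Fin 3), i < j →
      finSpatialCoord p i < M → finSpatialCoord p j < M →
      a (p, i) * a (p.shift i, j) * (a (p.shift j, i))⁻¹ * (a (p, j))⁻¹ = 1)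
    {x y z : ℕ} (hx : x ≤ M) (hy : y ≤ M) (hz : z ≤ M) {i j : Fin 3} (hij : i < j)
    (hi : ![x, y, z] i < M) (hj : ![x, y, z] j < M) :
    letI p : FinSpatialSite (M + 1) (M + 1) (M + 1) := ((x : Fin (M + 1)), (y : Fin (M + 1)), (z : Fin (M + 1)))
    (a (p, j))⁻¹ * a (p, i) * a (p.shift i, j) = a (p.shift j, i) := by
  set p : FinSpatialSite (M + 1) (M + 1) (M + 1) := ((x : Fin (M + 1)), (y : Fin (M + 1)), (z : Fin (M + 1))) with hpdef
  have h := hflat p i j hij (by rw [hpdef, finSpatialCoord_cast hx hy hz]; exact hi)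
    (by rw [hpdef, finSpatialCoord_cast hx hy hz]; exact hj)
  calc (a (p, j))⁻¹ * a (p, i) * a (p.shift i, j)
      = (a (p, j))⁻¹ * (a (p, i) * a (p.shift i, j) * (a (p.shift j, i))⁻¹ * (a (p, j))⁻¹) * a (p, j) * a (p.shift j, i) := by
        group
    _ = a (p.shift j, i) := by rw [h]; group

include hA hT in
/-- **Path independence across the plane `(1,2)`**: `T(x,y,z)⁻¹ T(x,y+1,z) = A(x,y,z;1)` for `y < M`, `z ≤ M` (every `x ≤ M`):
induction on `z`, one flat `(1,2)`-plaquette per step. -/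
theorem transport_link_one (hflat : ∀ (p : FinSpatialSite (M + 1) (M + 1) (M + 1)) (i j : Fin 3), i < j →
      finSpatialCoord p i < M → finSpatialCoord p j < M →
      a (p, i) * a (p.shift i, j) * (a (p.shift j, i))⁻¹ * (a (p, j))⁻¹ = 1)
    {x y : ℕ} (hx : x ≤ M) (hy : y < M) : ∀ {z : ℕ}, z ≤ M → (T x y z)⁻¹ * T x (y + 1) z = A x y z 1 := by
  intro z
  induction z with
  | zero =>
    intro _
    rw [transport_succ_one A T hT, inv_mul_cancel_left]
  | succ z ih =>
    intro hz
    have hz' : z < M := Nat.lt_of_succ_le hz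
    -- the flat plaquette `((x,y,z); 1, 2)`, in the parametrisation
    have h := far_link_eq_of_flat a hflat hx hy.le hz'.le (i := 1) (j := 2) (by decide) hy hz'
    simp only [shift_cast_one, shift_cast_two, ← hA] at h
    calc (T x y (z + 1))⁻¹ * T x (y + 1) (z + 1)
        = (A x y z 2)⁻¹ * ((T x y z)⁻¹ * T x (y + 1) z) * A x (y + 1) z 2 := by
          rw [transport_succ_two A T hT x y z, transport_succ_two A T hT x (y + 1) z]; group
      _ = A x y (z + 1) 1 := by rw [ih hz'.le, h]

include hA hT in
/-- **Path independence across the planes `(0,1)` and `(0,2)`**: `T(x,y,z)⁻¹ T(x+1,y,z) = A(x,y,z;0)` for `x < M`, `y, z ≤ M`: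
induction on `y` at `z = 0` (flat `(0,1)`-plaquettes), then on `z` (flat `(0,2)`-plaquettes). -/
theorem transport_link_zero (hflat : ∀ (p : FinSpatialSite (M + 1) (M + 1) (M + 1)) (i j : Fin 3), i < j →
      finSpatialCoord p i < M → finSpatialCoord p j < M →
      a (p, i) * a (p.shift i, j) * (a (p.shift j, i))⁻¹ * (a (p, j))⁻¹ = 1)
    {x : ℕ} (hx : x < M) : ∀ {z : ℕ}, z ≤ M → ∀ {y : ℕ}, y ≤ M → (T x y z)⁻¹ * T (x + 1) y z = A x y z 0 := by
  intro z
  induction z with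
  | zero =>
    intro _ y
    induction y with
    | zero =>
      intro _
      rw [transport_succ_zero A T hT, inv_mul_cancel_left]
    | succ y ih =>
      intro hy
      have hy' : y < M := Nat.lt_of_succ_le hy
      have h := far_link_eq_of_flat a hflat hx.le hy'.le (Nat.zero_le M) (i := 0) (j := 1) (by decide) hx hy'
      simp only [shift_cast_zero, shift_cast_one, ← hA] at h
      calc (T x (y + 1) 0)⁻¹ * T (x + 1) (y + 1) 0
          = (A x y 0 1)⁻¹ * ((T x y 0)⁻¹ * T (x + 1) y 0) * A (x + 1) y 0 1 := by
            rw [transport_succ_one A T hT x y, transport_succ_one A T hT (x + 1) y]; group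
        _ = A x (y + 1) 0 0 := by rw [ih hy'.le, h]
  | succ z ih =>
    intro hz y hy
    have hz' : z < M := Nat.lt_of_succ_le hz
    have h := far_link_eq_of_flat a hflat hx.le hy hz'.le (i := 0) (j := 2) (by decide) hx hz'
    simp only [shift_cast_zero, shift_cast_two, ← hA] at h
    calc (T x y (z + 1))⁻¹ * T (x + 1) y (z + 1)
        = (A x y z 2)⁻¹ * ((T x y z)⁻¹ * T (x + 1) y z) * A (x + 1) y z 2 := by
          rw [transport_succ_two A T hT x y z, transport_succ_two A T hT (x + 1) y z]; group
      _ = A x y (z + 1) 0 := by rw [ih hz'.le hy, h]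

include hT in
/-- Path independence in direction `2` is the definition: `T(x,y,z)⁻¹ T(x,y,z+1) = A(x,y,z;2)`. -/
theorem transport_link_two (x y z : ℕ) : (T x y z)⁻¹ * T x y (z + 1) = A x y z 2 := by
  rw [transport_succ_two A T hT, inv_mul_cancel_left]

end Transport

/-! ## §2 The Poincaré lemma of the open cube -/

section Poincare

variable {G : Type*} [Group G] {M : ℕ}

/-- **Discrete non-abelian Poincaré lemma of the open cube `{0..M}³` (helper (h1) of census row 46).**  Let `a` be a `G`-valued
link field on the spatial `Fin`-box `(M+1)³` of the transfer formalism, `G` ANY group.  If every NON-WRAPPING plaquette is flat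
— `a(p,i) a(p+eᵢ,j) a(p+eⱼ,i)⁻¹ a(p,j)⁻¹ = 1` whenever `i < j`, `pᵢ < M`, `pⱼ < M` (exactly the spatial plaquettes kept by the
line's `openInd`) —, then `a` is a PURE GAUGE on the open cube: there is `g : sites → G` with `a(p,i) = g(p) g(p+eᵢ)⁻¹` for every
non-wrapping link (`pᵢ < M`).  (`H¹` of the cubical complex of the solid cube vanishes; the flat fields of ONE time slice of the
open cube form ONE gauge orbit — the first input of the anchor O1; on the periodic box this fails: torons.)  Proof: `g(p)⁻¹` =
transport along the lexicographic path from the corner `(0,0,0)` (§1). [folklore: maximal-tree gauge, Seiler LNP 159 Ch. 2] -/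
theorem exists_gauge_of_plaquette_eq_one (a : FinSpatialSite (M + 1) (M + 1) (M + 1) × Fin 3 → G)
    (hflat : ∀ (p : FinSpatialSite (M + 1) (M + 1) (M + 1)) (i j : Fin 3), i < j →
      finSpatialCoord p i < M → finSpatialCoord p j < M →
      a (p, i) * a (p.shift i, j) * (a (p.shift j, i))⁻¹ * (a (p, j))⁻¹ = 1) :
    ∃ g : FinSpatialSite (M + 1) (M + 1) (M + 1) → G,
      ∀ (p : FinSpatialSite (M + 1) (M + 1) (M + 1)) (i : Fin 3), finSpatialCoord p i < M →
        a (p, i) = g p * (g (p.shift i))⁻¹ := by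
  -- the ℕ³-parametrised field and the transport (variables with their defining equations)
  obtain ⟨A, hA⟩ : ∃ A : ℕ → ℕ → ℕ → Fin 3 → G, ∀ x y z i, A x y z i =
      a ((((x : Fin (M + 1)), (y : Fin (M + 1)), (z : Fin (M + 1))) : FinSpatialSite (M + 1) (M + 1) (M + 1)), i) :=
    ⟨_, fun _ _ _ _ => rfl⟩
  obtain ⟨T, hT⟩ : ∃ T : ℕ → ℕ → ℕ → G, ∀ x y z, T x y z = ((List.range x).map fun k => A k 0 0 0).prod *
      ((List.range y).map fun k => A x k 0 1).prod * ((List.range z).map fun k => A x y k 2).prod :=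
    ⟨_, fun _ _ _ => rfl⟩
  refine ⟨fun p => (T (p.1 : ℕ) (p.2.1 : ℕ) (p.2.2 : ℕ))⁻¹, fun p i hi => ?_⟩
  obtain ⟨px, py, pz⟩ := p
  have hx : (px : ℕ) ≤ M := Nat.le_of_lt_succ px.isLt
  have hy : (py : ℕ) ≤ M := Nat.le_of_lt_succ py.isLt
  have hz : (pz : ℕ) ≤ M := Nat.le_of_lt_succ pz.isLt
  -- `p = (↑x, ↑y, ↑z)` for its coordinates
  have hp : ((((px : ℕ) : Fin (M + 1)), (((py : ℕ)) : Fin (M + 1)), (((pz : ℕ)) : Fin (M + 1))) :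
      FinSpatialSite (M + 1) (M + 1) (M + 1)) = (px, py, pz) :=
    cast_coord_eq ((px, py, pz) : FinSpatialSite (M + 1) (M + 1) (M + 1))
  simp only [inv_inv]
  fin_cases i
  · -- direction 0
    have hi' : (px : ℕ) < M := by simpa [finSpatialCoord] using hi
    have hs : FinSpatialSite.shift ((px, py, pz) : FinSpatialSite (M + 1) (M + 1) (M + 1)) 0 =
        ((((px : ℕ) + 1 : ℕ) : Fin (M + 1)), ((py : ℕ) : Fin (M + 1)), ((pz : ℕ) : Fin (M + 1))) := by
      rw [← hp, shift_cast_zero]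
    show a ((px, py, pz), 0) = (T (px : ℕ) (py : ℕ) (pz : ℕ))⁻¹ *
      T ((FinSpatialSite.shift ((px, py, pz) : FinSpatialSite (M + 1) (M + 1) (M + 1)) 0).1 : ℕ)
        ((FinSpatialSite.shift ((px, py, pz) : FinSpatialSite (M + 1) (M + 1) (M + 1)) 0).2.1 : ℕ)
        ((FinSpatialSite.shift ((px, py, pz) : FinSpatialSite (M + 1) (M + 1) (M + 1)) 0).2.2 : ℕ)
    rw [hs]
    rw [Fin.val_cast_of_lt (Nat.lt_succ_of_le hy), Fin.val_cast_of_lt (Nat.lt_succ_of_le hz),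
      Fin.val_cast_of_lt (Nat.succ_lt_succ hi'), transport_link_zero a A hA T hT hflat hi' hz hy, hA, hp]
  · -- direction 1
    have hi' : (py : ℕ) < M := by simpa [finSpatialCoord] using hi
    have hs : FinSpatialSite.shift ((px, py, pz) : FinSpatialSite (M + 1) (M + 1) (M + 1)) 1 =
        (((px : ℕ) : Fin (M + 1)), (((py : ℕ) + 1 : ℕ) : Fin (M + 1)), ((pz : ℕ) : Fin (M + 1))) := by
      rw [← hp, shift_cast_one]
    show a ((px, py, pz), 1) = (T (px : ℕ) (py : ℕ) (pz : ℕ))⁻¹ *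
      T ((FinSpatialSite.shift ((px, py, pz) : FinSpatialSite (M + 1) (M + 1) (M + 1)) 1).1 : ℕ)
        ((FinSpatialSite.shift ((px, py, pz) : FinSpatialSite (M + 1) (M + 1) (M + 1)) 1).2.1 : ℕ)
        ((FinSpatialSite.shift ((px, py, pz) : FinSpatialSite (M + 1) (M + 1) (M + 1)) 1).2.2 : ℕ)
    rw [hs]
    rw [Fin.val_cast_of_lt (Nat.lt_succ_of_le hx), Fin.val_cast_of_lt (Nat.lt_succ_of_le hz),
      Fin.val_cast_of_lt (Nat.succ_lt_succ hi'), transport_link_one a A hA T hT hflat hx hi' hz, hA, hp]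
  · -- direction 2
    have hi' : (pz : ℕ) < M := by simpa [finSpatialCoord] using hi
    have hs : FinSpatialSite.shift ((px, py, pz) : FinSpatialSite (M + 1) (M + 1) (M + 1)) 2 =
        (((px : ℕ) : Fin (M + 1)), ((py : ℕ) : Fin (M + 1)), (((pz : ℕ) + 1 : ℕ) : Fin (M + 1))) := by
      rw [← hp, shift_cast_two]
    show a ((px, py, pz), 2) = (T (px : ℕ) (py : ℕ) (pz : ℕ))⁻¹ *
      T ((FinSpatialSite.shift ((px, py, pz) : FinSpatialSite (M + 1) (M + 1) (M + 1)) 2).1 : ℕ)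
        ((FinSpatialSite.shift ((px, py, pz) : FinSpatialSite (M + 1) (M + 1) (M + 1)) 2).2.1 : ℕ)
        ((FinSpatialSite.shift ((px, py, pz) : FinSpatialSite (M + 1) (M + 1) (M + 1)) 2).2.2 : ℕ)
    rw [hs]
    rw [Fin.val_cast_of_lt (Nat.lt_succ_of_le hx), Fin.val_cast_of_lt (Nat.lt_succ_of_le hy),
      Fin.val_cast_of_lt (Nat.succ_lt_succ hi'), transport_link_two A T hT, hA, hp]

/-- **Corollary: a flat field on the open cube is gauge-equivalent to the trivial one** — in the vocabulary of the tree's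
slice gauge transformations (`finSliceGaugeTransform g x (p,i) = g p · x (p,i) · (g (p+eᵢ))⁻¹`): `a = 1^g` on every
non-wrapping link. -/
theorem exists_eq_gaugeTransform_one_of_plaquette_eq_one (a : FinSpatialSite (M + 1) (M + 1) (M + 1) × Fin 3 → G)
    (hflat : ∀ (p : FinSpatialSite (M + 1) (M + 1) (M + 1)) (i j : Fin 3), i < j →
      finSpatialCoord p i < M → finSpatialCoord p j < M →
      a (p, i) * a (p.shift i, j) * (a (p.shift j, i))⁻¹ * (a (p, j))⁻¹ = 1) :
    ∃ g : FinSpatialSite (M + 1) (M + 1) (M + 1) → G,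
      ∀ (p : FinSpatialSite (M + 1) (M + 1) (M + 1)) (i : Fin 3), finSpatialCoord p i < M →
        a (p, i) = finSliceGaugeTransform g 1 (p, i) := by
  obtain ⟨g, hg⟩ := exists_gauge_of_plaquette_eq_one a hflat
  refine ⟨g, fun p i hi => ?_⟩
  rw [hg p i hi, finSliceGaugeTransform, Pi.one_apply, mul_one]

end Poincare

end Summit.QuantumFields.YangMills.Cruxes.IRcof.OpenCubeContinuity
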